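import Literature.MathematicalPhysics.QuantumFieldTheory.Balaban1983to89.Node00.Record12CarriersB13
import Summits.QuantumFields.YangMills.Theorems.BalabanUVNodesN10AtRecord11B13

/-!
# BalabanUVNodes ∕ N10 AT NODE 00's [B13] GROUP OF RECORD, STAGE 12 — the pin at ₁₂, the `S_N10` shape of the presented Stage-12 record class, and N10's
# face for K1′'s «nodes at SOME Stage-12 record» in the SAME-unity-tuple currency (Track A, DAG node N10 [Balaban1988RG2Cluster] Lemmas 1–3 pp. 9, 11, 20;
# strategy s2 «by-name knit ∕ reduction at the record»; seat `pub-ymgap-dag-n10-d`; the `11 ↦ 12` re-key of §2–§3 of `…N10AtRecord11B13` (p459088), whose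
# §1 — the JUNCTION `b13LeafOfRecord_of_located` ∕ `_termwise` at Stage 3 — is UNCHANGED by the re-key and consumed by name)

HONEST FRAMING.  Count-neutral kernel bookkeeping over LANDED modules: NODE 00's `Record12CarriersB13` (def-B13 g2: the [B13] pin `Stage12Params.pinB13`, the
seven-pin Stage-12 view `view₁₂B13B12B8B10YZW`, the record `IsRecordOfRecord₁₂CB10YZWB8B12B13`, the pointed faces `b13_main_at_toStage5₁₂_pinB13`,
`upOfRecord₅CS_view₁₂B13B12B8B10YZW_b13_iff`, `datumOfRecord₁₂_pinB13` — all REUSED by name), def-T's `Record12` (`IsRecordOfRecord₁₂C`,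
`isRecordOfRecord₁₂C_of_eq`), `CarriersB13` §1–§2 (the residual [B13] term layer `ResidB13 θ`, `WtOfRecord`, `c13OfRecord`, `B13LeafOfRecord`, `XB13OfRecord` —
Stage-3 objects, untouched by the re-key) and this seat's `…N10AtRecord11B13` (§1: `b13LeafOfRecord_of_located`, `b13LeafOfRecord_of_located_termwise` —
the located Lemma 1–2 inputs + the Lemma-3 FLAG, resp. (2.26) per term + `Lemma3Numerics` at LEVEL T, give `B13LeafOfRecord θ₃ lam` at Stage 3; they plug
into `hleaf` below VERBATIM; dag-n10-c's `…N10AtRecord11B13Walks(Gamma)` give the same leaf from the NODE-A rung).  WHY THE RE-KEY: def-T's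
`Node00.not_isRecordOfRecord₁₁C` makes every Stage-11 record class EMPTY (11d's `alphaPos` is uninhabitable), so §2–§3 of the ₁₁ module speak about no
world; the Stage-12 record is the one the route's ₁₂ cruxes read (K1′ «StabilityBAtRecordR12e» = stmt-QuantumFields-19903 (rev 15; was 19790): θ-keyed ∃-currency — given a
unity tuple, SOME world of ITS datum with all nodes).  N10 is NOT discharged: the located inputs are HYPOTHESES about the HIDDEN residual layer and NODE A's
content (Lemma 3 ∕ (2.26) per term) is owned elsewhere; over the bare `IsRecordOfRecord₁₂CB10YZWB8B12B13` NO ∀-form of N10 is claimed (the layer is free data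
there — `Node00.exists_residB13_not_b13LeafOfRecord`, a Stage-3 fact, applies unchanged; def-B13's `exists_isRecordOfRecord₁₂CB10YZWB8B12B13_forall_not_b13`);
§2 states the `S_N10` shape only for record predicates PRESENTED WITH THE LEAF, §3 the ∃-form for the SAME unity tuple GIVEN the leaf at every run's layer.
Everything is MODULO THE DISPLAYED NON-DEGENERACY ∕ CONTENT caveat (def-B13: with empty OR full spaces and the ZERO term tower the leaf holds —
`exists_residB13_b13LeafOfRecord(_univ)`; contentfulness = a term tower OF RECORD, not in the tree; this seat's `…N10AtRecord11B13Nonvacuity` shows the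
junction's located hypothesis LIST is jointly satisfiable with full spaces, NOT content).  K0′ is NOT asserted.  Nothing of Bałaban's is asserted; no node
count moves; one finite four-torus programme at fixed ε per run; nothing continuum ∕ ℝ⁴ ∕ OS ∕ mass-gap ∕ Clay.  0 `sorry`, 0 `def`, standard axioms.  Filed
`--supports` K1′ (stmt-QuantumFields-19903, helper).

WHAT THIS FILE PROVES.  §1 `b13_main_at_view₁₂B13_of_leafOfRecord` (N10 at a run bound to the S-binding at the seven-pin Stage-12 view, from the leaf at the
layer of record), `b13_main_at_pinB13₁₂_of_leafOfRecord` (the same at the C-binding of the [B13]-pinned Stage-12 view — def-B13's `b13_main_at_toStage5₁₂_pinB13`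
with the in-edges unused); §2 `s_N10_of_presentedB13₁₂` (`S_N10 Rec` for every record predicate presented at the seven-pin Stage-12 view WITH the leaf at every
run), `exists_b13_main_of_isRecordOfRecord₁₂CB10YZWB8B12B13` (at a record of def-B13's ₁₂ class: the presenting package, and N10 at every run GIVEN the leaf at
its layer); §3 **`exists_record₁₂C_pinB13World_b13_main_of_leafOfRecord`** — N10's face for K1′'s registered stub «nodes at SOME Stage-12 record» in the
SAME-unity-tuple currency: for ANY admissible Stage-12 package `θ` with provisos `h` (its `ZtUnity`, if held, is θ's and untouched) and ANY per-run [B13] layer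
`lam13` carrying the leaf at every run, the world bound at the C-binding of the [B13]-PINNED view IS a ₁₂C record OF θ's OWN DATUM `datumOfRecord₁₂ θ h` (the pin
is UP-SIDE), with any window `γw ∈ ]0, θ.γ]`, block size `θ.L`, and `Dag.B13_main` at every run; and the HONESTY corollary `exists_record₁₂C_world_b13_main_of_zeroTower` —
with def-B13's zero term tower as the layer that face holds UNCONDITIONALLY at every admissible package's datum: as typed, N10's conjunct of `stub_nodes12` is
junk-dischargeable in the ∃-currency (content = a term tower OF RECORD, absent; said, not papered over).
-/

noncomputable section

namespace Summit.QuantumFields.YangMills.BalabanUVNodes.N10AtRecord12B13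

open Literature.MathematicalPhysics.QuantumFieldTheory.Balaban1983to89
open Literature.MathematicalPhysics.QuantumFieldTheory.Balaban1983to89.T4Continuum
open Literature.MathematicalPhysics.QuantumFieldTheory.Balaban1983to89.DagBinding
open Literature.MathematicalPhysics.QuantumFieldTheory.Balaban1983to89.Node00
open YMDAG.UVSplit (RecordPred S_N10)

/-! ## §1. The pin at Stage 12: N10 at a run bound at the seven-pin view (S-binding) ∕ at the C-binding of the [B13]-pinned view, from the leaf at the layer of record -/

section Pin

variable (F : T4Family) (N : ℕ) [NeZero N]
variable (θ : Stage12Params F N) (lam13 : B12.RunParams → ResidB13 θ.toStage3Params) (w : WorldP) (P : B12.RunParams)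

/-- **N10 AT A RUN BOUND TO THE S-BINDING AT NODE 00's SEVEN-PIN STAGE-12 VIEW, FROM THE LEAF AT THE LAYER OF RECORD** (the view's `b13` IS
`B13LeafOfRecord θ.toStage3Params (lam13 P)` — `Node00.upOfRecord₅CS_view₁₂B13B12B8B10YZW_b13_iff`, `Iff.rfl`; in-edges unused, as in every torus knit of the
lineage).  With `hleaf := N10AtRecord11B13.b13LeafOfRecord_of_located θ.toStage3Params (lam13 P) …` ∕ `…_termwise …` ∕ dag-n10-c's `…_walks₃ …` this is N10 at
the run from print's located input. [cite: Balaban1988RG2Cluster, Lemmas 1–3 pp.9, 11, 20; Balaban1989LargeFieldII, Thm 1 + (0.1) pp.355–356 (the record)] -/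
theorem b13_main_at_view₁₂B13_of_leafOfRecord (lam12 : ResidB12 F N θ.τ9.M) (lam8 : ResidB8 θ.toStage3Params) (Mstar : ℕ)
    (ops : OpsY N θ.toStage3Params Mstar) (ζ : ResidZ F N) (lamW : ResidW F N)
    (hup : w.up P = upOfRecord₅CS F N (θ.view₁₂B13B12B8B10YZW F N lam13 lam12 lam8 Mstar ops ζ lamW) P)
    (hleaf : B13LeafOfRecord θ.toStage3Params (lam13 P)) : Dag.B13_main (leavesP w P) := by
  rw [B13NodeKnitRecord5C.b13_main_iff_up, hup]
  exact fun _ _ _ _ => (upOfRecord₅CS_view₁₂B13B12B8B10YZW_b13_iff F N θ lam13 lam12 lam8 Mstar ops ζ lamW P).2 hleaf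

/-- **N10 AT A RUN BOUND TO THE C-BINDING OF THE [B13]-PINNED STAGE-12 VIEW `(θ.pinB13 lam13).toStage5₁₂`, FROM THE LEAF AT THE LAYER OF RECORD** — def-B13's
`Node00.b13_main_at_toStage5₁₂_pinB13` BY NAME with the in-edges unused (the re-bound bundle's [B13] group is `((WtOfRecord …).toStepData, c13OfRecord …)`
definitionally, `b13Leaf_withB13OfRecord_iff`). [cite: Balaban1988RG2Cluster, Lemmas 1–3 pp.9, 11, 20] -/
theorem b13_main_at_pinB13₁₂_of_leafOfRecord (hup : w.up P = upOfRecord₅C F N ((θ.pinB13 F N lam13).toStage5₁₂ F N) P)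
    (hleaf : B13LeafOfRecord θ.toStage3Params (lam13 P)) : Dag.B13_main (leavesP w P) :=
  b13_main_at_toStage5₁₂_pinB13 θ lam13 w P hup fun _ _ _ _ => hleaf

end Pin

/-! ## §2. The route stub shape `YMDAG.UVSplit.S_N10 Rec` at record predicates PRESENTED at the seven-pin Stage-12 view WITH the leaf; the ∃-form over def-B13's class -/

section Stub

variable {N : ℕ} [NeZero N]

/-- **`S_N10 Rec` FOR EVERY RECORD PREDICATE WHOSE WORLDS COME PRESENTED AT NODE 00's SEVEN-PIN STAGE-12 VIEW WITH THE [B13] LEAF AT THE LAYER OF RECORD AT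
EVERY RUN** — the shape a successor record instantiates whose LAW layer ∕ term tower OF RECORD makes `…N10AtRecord11B13` §1's located inputs THEOREMS about
its layer `lam13`; over the bare `IsRecordOfRecord₁₂CB10YZWB8B12B13` (layer = free data) no such ∀-form holds (`Node00.exists_residB13_not_b13LeafOfRecord`,
def-B13's `exists_isRecordOfRecord₁₂CB10YZWB8B12B13_forall_not_b13`) and none is claimed. [cite: Balaban1988RG2Cluster, Lemmas 1–3 pp.9, 11, 20; Balaban1989LargeFieldII, Thm 1 + (0.1) pp.355–356 (the record)] -/
theorem s_N10_of_presentedB13₁₂ (Rec : RecordPred N)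
    (hRec : ∀ (F : T4Family) (D : FiniteEpsData F (SU N)) (w : WorldP), Rec F D w →
      ∃ (θ : Stage12Params F N) (lam13 : B12.RunParams → ResidB13 θ.toStage3Params) (lam12 : ResidB12 F N θ.τ9.M) (lam8 : ResidB8 θ.toStage3Params)
        (Mstar : ℕ) (ops : OpsY N θ.toStage3Params Mstar) (ζ : ResidZ F N) (lamW : ResidW F N),
        (∀ P, w.up P = upOfRecord₅CS F N (θ.view₁₂B13B12B8B10YZW F N lam13 lam12 lam8 Mstar ops ζ lamW) P) ∧
          ∀ P, B13LeafOfRecord θ.toStage3Params (lam13 P)) :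
    S_N10 Rec := by
  intro F D w hw P
  obtain ⟨θ, lam13, lam12, lam8, Mstar, ops, ζ, lamW, hup, hleaf⟩ := hRec F D w hw
  exact b13_main_at_view₁₂B13_of_leafOfRecord F N θ lam13 w P lam12 lam8 Mstar ops ζ lamW (hup P) (hleaf P)

variable {F : T4Family}

/-- **AT A RECORD OF def-B13's STAGE-12 CLASS: the presenting package, and N10 at every run GIVEN THE LEAF AT ITS LAYER** — the ∃-form that DOES hold over the
bare `IsRecordOfRecord₁₂CB10YZWB8B12B13` (the leaf at `lam13 P` is the hypothesis a closer discharges from `…N10AtRecord11B13` §1's located inputs; the ∀-form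
without it is refutable at junk layers). [cite: Balaban1988RG2Cluster, Lemmas 1–3 pp.9, 11, 20; Balaban1989LargeFieldII, Thm 1 + (0.1) pp.355–356 (the record)] -/
theorem exists_b13_main_of_isRecordOfRecord₁₂CB10YZWB8B12B13 {D : FiniteEpsData F (SU N)} {w : WorldP}
    (h : IsRecordOfRecord₁₂CB10YZWB8B12B13 F N D w) :
    ∃ (θ : Stage12Params F N) (_ : θ.Provisos₁₂ F N) (lam13 : B12.RunParams → ResidB13 θ.toStage3Params), θ.Admissible F N ∧
      D = datumOfRecord₁₂ F N θ ‹θ.Provisos₁₂ F N› ∧ w.L = (θ.L : ℝ) ∧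
      ∀ P : B12.RunParams, B13LeafOfRecord θ.toStage3Params (lam13 P) → Dag.B13_main (leavesP w P) := by
  obtain ⟨θ, hP, lam13, lam12, lam8, Mstar, ops, ζ, lamW, hθ, hD, -, -, hL, hup⟩ := h
  exact ⟨θ, hP, lam13, hθ, hD, hL, fun P hleaf =>
    b13_main_at_view₁₂B13_of_leafOfRecord F N θ lam13 w P lam12 lam8 Mstar ops ζ lamW (hup P) hleaf⟩

end Stub

/-! ## §3. N10's face for K1′'s «nodes at SOME Stage-12 record», SAME unity tuple: the [B13]-pinned C-bound world IS a ₁₂C record of θ's OWN datum -/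

section K1Facing

variable (F : T4Family) (N : ℕ) [NeZero N]

/-- **FOR ANY ADMISSIBLE STAGE-12 PACKAGE `θ` WITH PROVISOS AND ANY PER-RUN [B13] LAYER CARRYING THE LEAF AT EVERY RUN, THE WORLD BOUND AT THE C-BINDING OF THE
[B13]-PINNED VIEW IS A ₁₂C RECORD OF θ's OWN DATUM WITH `Dag.B13_main` AT EVERY RUN** (any window `γw ∈ ]0, θ.γ]`, block size `θ.L`).  The pin is UP-SIDE
(`Node00.datumOfRecord₁₂_pinB13`: the pinned package `θ.pinB13 lam13` has θ's provisos, admissibility and datum; `θ.Zt` — hence `θ.ZtUnity` — is untouched),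
so this is N10's conjunct of K1′'s registered stub «given a unity tuple, SOME world of ITS datum at which every run's leaf world satisfies the nodes» —
modulo the leaf, which `…N10AtRecord11B13` §1 (located inputs + FLAG ∕ LEVEL T) or dag-n10-c's rung editions supply at the layer, and modulo the other twelve
nodes at the SAME world (their seats' faces at the C-binding of a pinned Stage-12 view).  Count-neutral; nothing of Bałaban's asserted.
[cite: Balaban1988RG2Cluster, Lemmas 1–3 pp.9, 11, 20; Balaban1989LargeFieldII, Thm 1 + (0.1) pp.355–356 (the record)] -/
theorem exists_record₁₂C_pinB13World_b13_main_of_leafOfRecord (θ : Stage12Params F N) (h : θ.Provisos₁₂ F N) (hθ : θ.Admissible F N)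
    (lam13 : B12.RunParams → ResidB13 θ.toStage3Params) {γw : ℝ} (hγw : 0 < γw ∧ γw ≤ θ.γ)
    (hleaf : ∀ P, B13LeafOfRecord θ.toStage3Params (lam13 P)) :
    ∃ w : WorldP, IsRecordOfRecord₁₂C F N (datumOfRecord₁₂ F N θ h) w ∧ w.γ = γw ∧ w.L = (θ.L : ℝ) ∧
      (∀ P, w.up P = upOfRecord₅C F N ((θ.pinB13 F N lam13).toStage5₁₂ F N) P) ∧ ∀ P : B12.RunParams, Dag.B13_main (leavesP w P) := by
  obtain ⟨w₀⟩ := nonempty_worldP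
  let w : WorldP :=
    { w₀ with
      C := (datumOfRecord₁₂ F N θ h).C, γ := γw, L := (θ.L : ℝ), one_lt_L := by exact_mod_cast θ.hL.2,
      up := fun P => upOfRecord₅C F N ((θ.pinB13 F N lam13).toStage5₁₂ F N) P }
  have hR : IsRecordOfRecord₁₂C F N (datumOfRecord₁₂ F N (θ.pinB13 F N lam13) (h.pinB13 lam13)) w :=
    isRecordOfRecord₁₂C_of_eq F N (θ.pinB13 F N lam13) (h.pinB13 lam13) ((Stage12Params.pinB13_admissible_iff F N θ lam13).2 hθ) w
      (by rw [datumOfRecord₁₂_pinB13 F N θ h lam13]) hγw rfl fun _ => rfl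
  rw [datumOfRecord₁₂_pinB13 F N θ h lam13] at hR
  exact ⟨w, hR, rfl, rfl, fun _ => rfl, fun P => b13_main_at_pinB13₁₂_of_leafOfRecord F N θ lam13 w P rfl (hleaf P)⟩

/-- **HONESTY (R433 species) — N10's CONJUNCT OF K1′'s «NODES AT SOME STAGE-12 RECORD» IS JUNK-DISCHARGEABLE IN THE ∃-CURRENCY, AT EVERY UNITY TUPLE's DATUM.**
For ANY admissible Stage-12 package `θ` with provisos (whatever its `Zt`, so in particular for every unity tuple) and any window `γw ∈ ]0, θ.γ]` there IS a ₁₂C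
record world of θ's OWN datum with `Dag.B13_main` at EVERY run — obtained from §3 with `lam13 :=` def-B13's ZERO TERM TOWER WITH FULL SPACES
(`Node00.exists_residB13_b13LeafOfRecord_univ`: all (1.33)∕(2.9) terms zero, `sp1 = sp2 = univ`, constancy invariance clause; every printed bound reads
`0 ≤ prefactor·exp(…)`).  WHAT THIS SAYS (for plan g64 ∕ the referees, not against print): as typed, the N10 conjunct of `stub_nodes12` — «∃ world of the tuple's
datum with … `B13_main` …» — carries NO content of [Balaban1988RG2Cluster]: the ∃-currency lets the prover pick the [B13] layer, and no `Prop`-law over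
`ResidB13`'s fields excludes the zero tower (def-B13 `Record12CarriersB13` §5); content enters only when `lam13` is PINNED to a TERM TOWER OF RECORD (the
identification of the terms with the record's expansion (1.25)–(1.33), (1.41), (2.9)–(2.14) — a construction keyed on `Stage12Params`, not in the tree) and the
leaf is then supplied by `…N10AtRecord11B13` §1 from located inputs that are THEOREMS about that tower.  Nothing of Bałaban's is refuted or asserted; count-neutral.
[cite: Balaban1988RG2Cluster, (1.33) p.9, (1.41)–(1.42) p.11, (2.9)–(2.14) pp.14–15 (the terms are the expansion's, in print); Lemmas 1–3 pp.9, 11, 20] -/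
theorem exists_record₁₂C_world_b13_main_of_zeroTower (θ : Stage12Params F N) (h : θ.Provisos₁₂ F N) (hθ : θ.Admissible F N) {γw : ℝ}
    (hγw : 0 < γw ∧ γw ≤ θ.γ) :
    ∃ w : WorldP, IsRecordOfRecord₁₂C F N (datumOfRecord₁₂ F N θ h) w ∧ w.γ = γw ∧ w.L = (θ.L : ℝ) ∧ ∀ P : B12.RunParams, Dag.B13_main (leavesP w P) := by
  obtain ⟨lam, -, -, -, hleaf⟩ := exists_residB13_b13LeafOfRecord_univ θ.toStage3Params
  obtain ⟨w, hR, hγ, hL, -, hN⟩ := exists_record₁₂C_pinB13World_b13_main_of_leafOfRecord F N θ h hθ (fun _ => lam) hγw fun _ => hleaf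
  exact ⟨w, hR, hγ, hL, hN⟩

end K1Facing

end Summit.QuantumFields.YangMills.BalabanUVNodes.N10AtRecord12B13

end
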